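import Summits.Ventures.LatticeQCDFlow.Exactness.Phi4MetropolisScan
import Summits.Ventures.LatticeQCDFlow.Exactness.ReversibleDirichletFloor
import Summits.Ventures.LatticeQCDFlow.Exactness.MetropolisLineEnergyBound
import Literature.Analysis.FunctionSpaces.TorusLipschitzFourierH1
import HarnessLib

/-!
# The ENERGY floor of the local Metropolis arm, window-independent: `τ_int,sweep(f(S)) ≥ (e²/4) Var(f(S))/V − ½`

HONEST FRAMING: exact (Metropolis-corrected) sampling algorithms for lattice gauge theory;
figures of merit are autocorrelation/cost numbers at stated couplings and volumes; no
continuum-physics claim.  (SCALAR calibration rung S0-A: not a gauge result.)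

Venture `LatticeQCDFlow` (cell pub-lqcd), topic `Exactness`; FANOUT row 2 (`s0-phi4`, LOCAL arm).
NEW WORK of the cell, composing `MetropolisLineEnergyBound` (`⟨(ΔS)²⟩ ≤ 8/e²` on each coordinate
line), `Phi4MetropolisScan` (the random-site-scan operator, its bounded-observable class) and
`ReversibleDirichletFloor` (averaged carré-du-champ floor).  Nothing is cited as a fact.  Printed
counterpart, NAMED ONLY: Caracciolo–Pelissetto–Sokal 1994 (PRL 72:179), Theorem
`τ_int,H ≥ (e²/4) var(H)/f₊ − ½` per Metropolis step on a finite state space, with the remark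
"`τ ≳ C_h` in sweeps … a well-known result"; HERE: continuum lattice φ⁴, sweep units made
rigorous by the thinned floor, general state space, and the observable any bounded 1-Lipschitz
function of the action (e.g. the clipped action) — the action itself needs the degree-8 analogue of
`QuadObs` and is not typed here.

## What is proved (`Λ = Fin (n+1)`, coercive action `S`, e.g. every `λ > 0`; `ρ` an even probability density — NO window needed)

* `integrable_lineIntegral` — `x' ↦ ∫ G(insertNth x t x') dt` is integrable when `G` is;
* **`site_energy_carre_le`** — for bounded measurable `f` with
  `|f(φ|φ_x:=t') − f(φ)| ≤ |S(φ|φ_x:=t') − S(φ)|`: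
  `∫ (∫ a_x(φ,t') (f(φ|φ_x:=t') − f φ)² ρ(t' − φ_x) dt') e^{−S(φ)} dφ ≤ 8 e^{−2} Z` for every site;
  **`integral_metroScan_sq_dev_le_energy`** — hence `∫ K[(f − f φ)²](φ) e^{−S} ≤ 8 e^{−2} Z`;
* **`metropolisScan_tauInt_sweep_ge_energy`** — `λ > 0`, any `J`, any even step density,
  `g = f − ⟨f⟩`: summable sweep-thinned series and `ρ_g(n+1) < 1` ⇒
  `τ_int,sweep(f) ≥ (e²/4) ⟨(f − ⟨f⟩)²⟩/(n+1) − ½`;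
* `clipAction_bddObs`, `clipAction_lipschitz`, **`metropolisScan_tauInt_sweep_ge_clipAction`** —
  the instance `f = max(−N, min(N, S))` for every clip level `N`.

Reading (no numerics implied): whatever the proposal window, the random-scan local Metropolis arm
needs at least `(e²/4)·Var(clip_N S)/V − ½ ≈ 1.85·c − ½` sweeps per independent sample of the
action, `c = Var/V` the specific-heat-like variance per site (`→ Var(S)/V` as `N → ∞`): the energy
diffuses by `O(1)` per accepted proposal however large the step (`z_int,S ≥ α/ν`).
NOT CLAIMED: the ordered sweep; `ρ_g < 1` / summability (hypotheses); the unclipped action; the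
factor `f₊ ≤ 1` of the printed statement (dropped).
-/

namespace Summit.Ventures.LatticeQCDFlow.Exactness

open Real MeasureTheory Filter Finset
open Summit.Ventures.LatticeQCDFlow.Scoring

section ActionCSD

variable {n : ℕ}

/-- Line integrals of an integrable function on `ℝ^{n+1}` are integrable in the remaining
coordinates: `x' ↦ ∫ G(insertNth x t x') dt` is integrable. -/
theorem integrable_lineIntegral (x : Fin (n + 1)) {G : (Fin (n + 1) → ℝ) → ℝ} (hG : Integrable G) :
    Integrable (fun x' : Fin n → ℝ => ∫ t : ℝ, G (Fin.insertNth x t x')) := by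
  set e := MeasurableEquiv.piFinSuccAbove (fun _ : Fin (n + 1) => ℝ) x with he
  have hmp : MeasurePreserving e := volume_preserving_piFinSuccAbove (fun _ : Fin (n + 1) => ℝ) x
  have hG' : Integrable (fun z : ℝ × (Fin n → ℝ) => G (e.symm z))
      ((volume : Measure ℝ).prod (volume : Measure (Fin n → ℝ))) :=
    (hmp.symm e).integrable_comp_emb e.symm.measurableEmbedding |>.2 hG
  exact hG'.integral_prod_right

/-- **The per-site energy bound.**  Coercive action, even step density `ρ`, `f` bounded measurable
with `|f(φ|φ_x:=t') − f(φ)| ≤ |S(φ|φ_x:=t') − S(φ)|`.  Then for every site `x`: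
`∫ (∫ min(1, e^{−ΔS}) (f(φ|φ_x:=t') − f φ)² ρ(t' − φ_x) dt') e^{−S(φ)} dφ ≤ 8 e^{−2} ∫ e^{−S}`. -/
theorem site_energy_carre_le {J : Fin (n + 1) → Fin (n + 1) → ℝ} {lam ε K : ℝ} (hε : 0 < ε)
    (hS : ∀ φ : Fin (n + 1) → ℝ, ε * ∑ w, φ w ^ 2 - K ≤ latticePhi4Action J lam φ)
    {ρ : ℝ → ℝ} (hρ0 : ∀ u, 0 ≤ ρ u) (hρm : Measurable ρ) (hρi : Integrable ρ)
    (hρ1 : ∫ u, ρ u = 1) (hρs : ∀ u, ρ (-u) = ρ u) {f : (Fin (n + 1) → ℝ) → ℝ} (hf : BddObs f)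
    (hfS : ∀ (φ : Fin (n + 1) → ℝ) (x : Fin (n + 1)) (t' : ℝ),
      |f (Function.update φ x t') - f φ|
        ≤ |latticePhi4Action J lam (Function.update φ x t') - latticePhi4Action J lam φ|)
    (x : Fin (n + 1)) :
    ∫ φ, (∫ t', metroAccept J lam x φ t' * (f (Function.update φ x t') - f φ) ^ 2 * ρ (t' - φ x))
        * gibbsWeight J lam φ
      ≤ 8 * Real.exp (-2) * ∫ φ, gibbsWeight J lam φ := by
  obtain ⟨hfm, B, hfb⟩ := hf
  have hw_int : Integrable (gibbsWeight J lam) := integrable_gibbsWeight_of_coercive hε hS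
  have hw : Measurable (gibbsWeight J lam) := (continuous_gibbsWeight J lam).measurable
  -- the `φ`-integrand is integrable (bounded inner integral × integrable weight)
  have hupd : Measurable fun p : (Fin (n + 1) → ℝ) × ℝ => Function.update p.1 x p.2 :=
    measurable_update'
  have ha : Measurable fun p : (Fin (n + 1) → ℝ) × ℝ => metroAccept J lam x p.1 p.2 := by
    unfold metroAccept
    exact measurable_const.min ((hw.comp hupd).div (hw.comp measurable_fst))
  have hF : Measurable fun p : (Fin (n + 1) → ℝ) × ℝ =>
      metroAccept J lam x p.1 p.2 * (f (Function.update p.1 x p.2) - f p.1) ^ 2 * ρ (p.2 - p.1 x) :=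
    (ha.mul (((hfm.comp hupd).sub (hfm.comp measurable_fst)).pow_const 2)).mul
      (hρm.comp (measurable_snd.sub ((measurable_pi_apply x).comp measurable_fst)))
  have hinner_m : Measurable fun φ : Fin (n + 1) → ℝ =>
      ∫ t', metroAccept J lam x φ t' * (f (Function.update φ x t') - f φ) ^ 2 * ρ (t' - φ x) :=
    hF.stronglyMeasurable.integral_prod_right'.measurable
  have hinner_b : ∀ φ : Fin (n + 1) → ℝ,
      |∫ t', metroAccept J lam x φ t' * (f (Function.update φ x t') - f φ) ^ 2 * ρ (t' - φ x)|
        ≤ (2 * B) ^ 2 := by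
    intro φ
    have hρt : Integrable (fun t' => ρ (t' - φ x)) := hρi.comp_sub_right (φ x)
    have h : ‖∫ t', metroAccept J lam x φ t' * (f (Function.update φ x t') - f φ) ^ 2 * ρ (t' - φ x)‖
        ≤ ∫ t', (2 * B) ^ 2 * ρ (t' - φ x) := by
      refine norm_integral_le_of_norm_le (hρt.const_mul ((2 * B) ^ 2))
        (Eventually.of_forall fun t' => ?_)
      obtain ⟨ha0, ha1⟩ := metroAccept_nonneg_le J lam x φ t'
      rw [Real.norm_eq_abs, abs_mul, abs_mul, abs_of_nonneg ha0, abs_of_nonneg (hρ0 _),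
        abs_of_nonneg (sq_nonneg _)]
      have hd : |f (Function.update φ x t') - f φ| ≤ 2 * B := by
        calc |f (Function.update φ x t') - f φ| ≤ |f (Function.update φ x t')| + |f φ| := abs_sub _ _
          _ ≤ B + B := add_le_add (hfb _) (hfb _)
          _ = 2 * B := by ring
      have hsq : (f (Function.update φ x t') - f φ) ^ 2 ≤ (2 * B) ^ 2 := by
        rw [← sq_abs]
        exact pow_le_pow_left₀ (abs_nonneg _) hd 2
      calc metroAccept J lam x φ t' * (f (Function.update φ x t') - f φ) ^ 2 * ρ (t' - φ x)
          ≤ 1 * (2 * B) ^ 2 * ρ (t' - φ x) := by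
            gcongr
            exact hρ0 _
        _ = (2 * B) ^ 2 * ρ (t' - φ x) := by ring
    rw [integral_const_mul, integral_sub_right_eq_self (μ := (volume : Measure ℝ)) ρ (φ x), hρ1,
      mul_one, Real.norm_eq_abs] at h
    exact h
  have hG : Integrable (fun φ => (∫ t', metroAccept J lam x φ t'
      * (f (Function.update φ x t') - f φ) ^ 2 * ρ (t' - φ x)) * gibbsWeight J lam φ) :=
    integrable_bdd_mul_weight (μ := volume) hinner_m hinner_b hw
      (fun φ => (gibbsWeight_pos J lam φ).le) hw_int
  -- split off the `x`-coordinate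
  rw [integral_eq_integral_insertNth x hG, integral_eq_integral_insertNth x hw_int,
    ← integral_const_mul]
  refine integral_mono_of_nonneg (Eventually.of_forall fun x' => ?_)
    ((integrable_lineIntegral x hw_int).const_mul _) (Eventually.of_forall fun x' => ?_)
  · exact integral_nonneg fun t => mul_nonneg (integral_nonneg fun t' =>
      mul_nonneg (mul_nonneg (metroAccept_nonneg_le J lam x _ t').1 (sq_nonneg _)) (hρ0 _))
      (gibbsWeight_pos J lam _).le
  · -- along the line through `ψ = insertNth x 0 x'`: the one-dimensional lemma
    set ψ : Fin (n + 1) → ℝ := Fin.insertNth x (0 : ℝ) x' with hψ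
    have hψx : ψ x = 0 := by simp [hψ]
    have hins : ∀ t : ℝ, (Fin.insertNth x t x' : Fin (n + 1) → ℝ) = Function.update ψ x t :=
      fun t => insertNth_eq_update x t x'
    simp only [hins]
    set Sl : ℝ → ℝ := fun t => latticePhi4Action J lam (Function.update ψ x t) with hSl
    set fl : ℝ → ℝ := fun t => f (Function.update ψ x t) with hfl
    have hSlm : Measurable Sl := (continuous_latticePhi4Action J lam).measurable.comp
      (measurable_update' (a := x) |>.comp (measurable_const.prodMk measurable_id))
    have hwl : Integrable (fun t => Real.exp (-Sl t)) := integrable_gibbsWeight_line hε hS ψ x hψx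
    have hflS : ∀ t t', |fl t' - fl t| ≤ |Sl t' - Sl t| := by
      intro t t'
      have h := hfS (Function.update ψ x t) x t'
      simp only [Function.update_idem] at h
      exact h
    have key := line_energy_carre_le hSlm hwl hρ0 hρm hρi hρ1 hρs hflS
    have hK : ∀ t, (∫ t', metroAccept J lam x (Function.update ψ x t) t'
        * (f (Function.update (Function.update ψ x t) x t') - f (Function.update ψ x t)) ^ 2
        * ρ (t' - Function.update ψ x t x)) * gibbsWeight J lam (Function.update ψ x t)
        = (∫ t', min 1 (Real.exp (-Sl t') / Real.exp (-Sl t)) * (fl t' - fl t) ^ 2 * ρ (t' - t))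
          * Real.exp (-Sl t) := by
      intro t
      unfold metroAccept gibbsWeight
      simp only [Function.update_idem, Function.update_self, hSl, hfl]
    simp only [hK]
    exact key

/-- **Averaged energy move bound for the scan**: `∫ K[(f − f φ)²](φ) e^{−S} dφ ≤ 8 e^{−2} Z`. -/
theorem integral_metroScan_sq_dev_le_energy {J : Fin (n + 1) → Fin (n + 1) → ℝ} {lam ε K : ℝ}
    (hε : 0 < ε) (hS : ∀ φ : Fin (n + 1) → ℝ, ε * ∑ w, φ w ^ 2 - K ≤ latticePhi4Action J lam φ)
    {ρ : ℝ → ℝ} (hρ0 : ∀ u, 0 ≤ ρ u) (hρm : Measurable ρ) (hρi : Integrable ρ)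
    (hρ1 : ∫ u, ρ u = 1) (hρs : ∀ u, ρ (-u) = ρ u) {f : (Fin (n + 1) → ℝ) → ℝ} (hf : BddObs f)
    (hfS : ∀ (φ : Fin (n + 1) → ℝ) (x : Fin (n + 1)) (t' : ℝ),
      |f (Function.update φ x t') - f φ|
        ≤ |latticePhi4Action J lam (Function.update φ x t') - latticePhi4Action J lam φ|) :
    ∫ φ, metroScan J lam ρ (fun ψ => (f ψ - f φ) ^ 2) φ * gibbsWeight J lam φ
      ≤ 8 * Real.exp (-2) * ∫ φ, gibbsWeight J lam φ := by
  have hn : (0 : ℝ) < (n : ℝ) + 1 := by positivity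
  have hsite := fun x => site_energy_carre_le hε hS hρ0 hρm hρi hρ1 hρs hf hfS x
  -- rewrite the scan integrand as the site average of the per-site integrands
  have e : ∀ φ, metroScan J lam ρ (fun ψ => (f ψ - f φ) ^ 2) φ * gibbsWeight J lam φ
      = (∑ x, (∫ t', metroAccept J lam x φ t' * (f (Function.update φ x t') - f φ) ^ 2
          * ρ (t' - φ x)) * gibbsWeight J lam φ) / ((n : ℝ) + 1) := by
    intro φ
    unfold metroScan metroSite
    simp only [sub_self, zero_pow (two_ne_zero), mul_zero, add_zero]
    rw [div_mul_eq_mul_div, Finset.sum_mul]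
  simp_rw [e]
  -- integrability of each site term: it is dominated by `(2B)² w` — reuse the per-site proof's bound
  obtain ⟨hfm, B, hfb⟩ := hf
  have hw_int : Integrable (gibbsWeight J lam) := integrable_gibbsWeight_of_coercive hε hS
  have hw : Measurable (gibbsWeight J lam) := (continuous_gibbsWeight J lam).measurable
  have hint : ∀ x : Fin (n + 1), Integrable (fun φ => (∫ t', metroAccept J lam x φ t'
      * (f (Function.update φ x t') - f φ) ^ 2 * ρ (t' - φ x)) * gibbsWeight J lam φ) := by
    intro x
    have hupd : Measurable fun p : (Fin (n + 1) → ℝ) × ℝ => Function.update p.1 x p.2 :=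
      measurable_update'
    have ha : Measurable fun p : (Fin (n + 1) → ℝ) × ℝ => metroAccept J lam x p.1 p.2 := by
      unfold metroAccept
      exact measurable_const.min ((hw.comp hupd).div (hw.comp measurable_fst))
    have hF : Measurable fun p : (Fin (n + 1) → ℝ) × ℝ =>
        metroAccept J lam x p.1 p.2 * (f (Function.update p.1 x p.2) - f p.1) ^ 2
          * ρ (p.2 - p.1 x) :=
      (ha.mul (((hfm.comp hupd).sub (hfm.comp measurable_fst)).pow_const 2)).mul
        (hρm.comp (measurable_snd.sub ((measurable_pi_apply x).comp measurable_fst)))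
    refine integrable_bdd_mul_weight (μ := volume) hF.stronglyMeasurable.integral_prod_right'.measurable
      (C := (2 * B) ^ 2) (fun φ => ?_) hw (fun φ => (gibbsWeight_pos J lam φ).le) hw_int
    have hρt : Integrable (fun t' => ρ (t' - φ x)) := hρi.comp_sub_right (φ x)
    have h : ‖∫ t', metroAccept J lam x φ t' * (f (Function.update φ x t') - f φ) ^ 2 * ρ (t' - φ x)‖
        ≤ ∫ t', (2 * B) ^ 2 * ρ (t' - φ x) := by
      refine norm_integral_le_of_norm_le (hρt.const_mul ((2 * B) ^ 2))
        (Eventually.of_forall fun t' => ?_)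
      obtain ⟨ha0, ha1⟩ := metroAccept_nonneg_le J lam x φ t'
      rw [Real.norm_eq_abs, abs_mul, abs_mul, abs_of_nonneg ha0, abs_of_nonneg (hρ0 _),
        abs_of_nonneg (sq_nonneg _)]
      have hd : |f (Function.update φ x t') - f φ| ≤ 2 * B := by
        calc |f (Function.update φ x t') - f φ| ≤ |f (Function.update φ x t')| + |f φ| := abs_sub _ _
          _ ≤ B + B := add_le_add (hfb _) (hfb _)
          _ = 2 * B := by ring
      have hsq : (f (Function.update φ x t') - f φ) ^ 2 ≤ (2 * B) ^ 2 := by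
        rw [← sq_abs]
        exact pow_le_pow_left₀ (abs_nonneg _) hd 2
      calc metroAccept J lam x φ t' * (f (Function.update φ x t') - f φ) ^ 2 * ρ (t' - φ x)
          ≤ 1 * (2 * B) ^ 2 * ρ (t' - φ x) := by
            gcongr
            exact hρ0 _
        _ = (2 * B) ^ 2 * ρ (t' - φ x) := by ring
    rw [integral_const_mul, integral_sub_right_eq_self (μ := (volume : Measure ℝ)) ρ (φ x), hρ1,
      mul_one, Real.norm_eq_abs] at h
    exact h
  rw [integral_div, integral_finsetSum _ fun x _ => hint x, div_le_iff₀ hn]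
  calc ∑ x, ∫ φ, (∫ t', metroAccept J lam x φ t' * (f (Function.update φ x t') - f φ) ^ 2
          * ρ (t' - φ x)) * gibbsWeight J lam φ
      ≤ ∑ _x : Fin (n + 1), 8 * Real.exp (-2) * ∫ φ, gibbsWeight J lam φ :=
        Finset.sum_le_sum fun x _ => hsite x
    _ = 8 * Real.exp (-2) * (∫ φ, gibbsWeight J lam φ) * ((n : ℝ) + 1) := by
        rw [Finset.sum_const, Finset.card_univ, Fintype.card_fin, nsmul_eq_mul]
        push_cast
        ring

/-- The bookkeeping `2 (P/Z) … = (e²/4)(P/Z)/V`: `2 P / (V · 8e^{−2} Z) = (e²/4) (P/Z) / V`. -/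
theorem energy_floor_transfer {Z : ℝ} (hZ : Z ≠ 0) (n : ℕ) (P : ℝ) :
    Real.exp 2 / 4 * (P / Z) / ((n : ℝ) + 1) - 1 / 2
      = 2 * P / (((n + 1 : ℕ) : ℝ) * (8 * Real.exp (-2) * Z)) - 1 / 2 := by
  have he : Real.exp (-2) = (Real.exp 2)⁻¹ := Real.exp_neg 2
  have he0 : Real.exp 2 ≠ 0 := (Real.exp_pos 2).ne'
  push_cast
  rw [he]
  field_simp
  ring

/-- **THE ENERGY FLOOR OF THE RANDOM-SCAN LOCAL METROPOLIS ARM (Caracciolo–Pelissetto–Sokal, sweep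
units).**  Lattice φ⁴, every `λ > 0`, every real `J`, EVERY even step density `ρ` (no window);
`f` bounded measurable with `|f(φ|φ_x:=t') − f(φ)| ≤ |S(φ|φ_x:=t') − S(φ)|`, `g = f − ⟨f⟩`, one
sweep = `n+1` random site updates.  Summable sweep-thinned series and `ρ_g(n+1) < 1` ⇒
`τ_int,sweep(f) ≥ (e²/4) ⟨(f − ⟨f⟩)²⟩ / (n+1) − ½`. -/
theorem metropolisScan_tauInt_sweep_ge_energy {lam : ℝ} (hlam : 0 < lam)
    (J : Fin (n + 1) → Fin (n + 1) → ℝ) {ρ : ℝ → ℝ} (hρ0 : ∀ u, 0 ≤ ρ u) (hρm : Measurable ρ)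
    (hρi : Integrable ρ) (hρ1 : ∫ u, ρ u = 1) (hρs : ∀ u, ρ (-u) = ρ u)
    {f : (Fin (n + 1) → ℝ) → ℝ} (hf : BddObs f)
    (hfS : ∀ (φ : Fin (n + 1) → ℝ) (x : Fin (n + 1)) (t' : ℝ),
      |f (Function.update φ x t') - f φ|
        ≤ |latticePhi4Action J lam (Function.update φ x t') - latticePhi4Action J lam φ|)
    (hs : Summable fun k => (∫ φ, (f φ - gibbsExpect J lam f)
        * ((metroScan J lam ρ)^[(n + 1) * (k + 1)] (fun ψ => f ψ - gibbsExpect J lam f)) φ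
        * gibbsWeight J lam φ) / ∫ φ, (f φ - gibbsExpect J lam f) ^ 2 * gibbsWeight J lam φ)
    (hρV : (∫ φ, (f φ - gibbsExpect J lam f)
        * ((metroScan J lam ρ)^[n + 1] (fun ψ => f ψ - gibbsExpect J lam f)) φ * gibbsWeight J lam φ)
        / (∫ φ, (f φ - gibbsExpect J lam f) ^ 2 * gibbsWeight J lam φ) < 1) :
    Real.exp 2 / 4 * gibbsExpect J lam (fun φ => (f φ - gibbsExpect J lam f) ^ 2) / (n + 1) - 1 / 2
      ≤ tauInt (fun k => (∫ φ, (f φ - gibbsExpect J lam f)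
          * ((metroScan J lam ρ)^[(n + 1) * k] (fun ψ => f ψ - gibbsExpect J lam f)) φ
          * gibbsWeight J lam φ) / ∫ φ, (f φ - gibbsExpect J lam f) ^ 2 * gibbsWeight J lam φ) := by
  have hco := latticePhi4Action_coercive hlam J
  obtain ⟨hfm, B, hfb⟩ := hf
  obtain ⟨hgm, hgb, -⟩ := centred_observable hlam J hfm hfb
  have hg : BddObs (fun ψ => f ψ - gibbsExpect J lam f) := ⟨hgm, _, hgb⟩
  have hgS : ∀ (φ : Fin (n + 1) → ℝ) (x : Fin (n + 1)) (t' : ℝ),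
      |(f (Function.update φ x t') - gibbsExpect J lam f) - (f φ - gibbsExpect J lam f)|
        ≤ |latticePhi4Action J lam (Function.update φ x t') - latticePhi4Action J lam φ| := by
    intro φ x t'
    rw [show (f (Function.update φ x t') - gibbsExpect J lam f) - (f φ - gibbsExpect J lam f)
      = f (Function.update φ x t') - f φ by ring]
    exact hfS φ x t'
  have hΓ := integral_metroScan_sq_dev_le_energy one_pos hco hρ0 hρm hρi hρ1 hρs hg hgS
  have hfloor := RevOp.thinned_tauInt_ge_of_integral_carre_le (μ := volume) (A := BddObs)
    (K := metroScan J lam ρ) (w := gibbsWeight J lam)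
    (fun φ => (gibbsWeight_pos J lam φ).le) (bddObs_const 1)
    (fun f h hf hh => bddObs_integrable_mul_mul_gibbsWeight one_pos hco hf hh)
    (fun f h c hf hh => bddObs_add_mul hf hh c)
    (fun f hf => bddObs_metroScan J lam hρ0 hρm hρi hρ1 hf)
    (fun f h c hf hh x => metroScan_add_mul J lam hρ0 hρm hρi hf hh c x)
    (fun f h hf hh => metroScan_reversible one_pos hco hρ0 hρm hρi hρ1 hρs hf hh)
    (fun f hf => metroScan_contraction one_pos hco hρ0 hρm hρi hρ1 hρs hf)
    (fun φ => metroScan_one J lam hρ1 φ) hg (bddObs_sq hg) hΓ (show 0 < n + 1 by omega) hs hρV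
  have hZ : gibbsZ J lam ≠ 0 := (gibbsZ_pos hlam J).ne'
  exact (energy_floor_transfer hZ n _).le.trans hfloor

/-- The clipped action `max(−N, min(N, S))` is a bounded measurable observable. -/
theorem clipAction_bddObs (J : Fin (n + 1) → Fin (n + 1) → ℝ) (lam N : ℝ) :
    BddObs (fun φ : Fin (n + 1) → ℝ => max (-N) (min N (latticePhi4Action J lam φ))) := by
  refine ⟨measurable_const.max (measurable_const.min
    (continuous_latticePhi4Action J lam).measurable), |N|, fun φ => abs_le.mpr ⟨?_, ?_⟩⟩
  · exact (neg_le_neg (le_abs_self N)).trans (le_max_left _ _)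
  · exact max_le (neg_le_abs N) ((min_le_left N _).trans (le_abs_self N))

/-- The clipped action moves no more than the action. -/
theorem clipAction_lipschitz (J : Fin (n + 1) → Fin (n + 1) → ℝ) (lam N : ℝ)
    (φ : Fin (n + 1) → ℝ) (x : Fin (n + 1)) (t' : ℝ) :
    |max (-N) (min N (latticePhi4Action J lam (Function.update φ x t')))
        - max (-N) (min N (latticePhi4Action J lam φ))|
      ≤ |latticePhi4Action J lam (Function.update φ x t') - latticePhi4Action J lam φ| :=
  Literature.Analysis.FunctionSpaces.abs_clamp_sub_clamp_le N _ _

/-- **THE ENERGY FLOOR FOR THE CLIPPED ACTION.**  Every `λ > 0`, every real `J`, every even step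
density, every clip level `N`; with `f_N = max(−N, min(N, S))`, `g = f_N − ⟨f_N⟩`: summable
sweep-thinned series and `ρ_g(n+1) < 1` ⇒ `τ_int,sweep(f_N) ≥ (e²/4) Var(f_N)/(n+1) − ½`
(`Var(f_N)/(n+1) → Var(S)/(n+1)`, the variance of the action per site, as `N → ∞`). -/
theorem metropolisScan_tauInt_sweep_ge_clipAction {lam : ℝ} (hlam : 0 < lam)
    (J : Fin (n + 1) → Fin (n + 1) → ℝ) {ρ : ℝ → ℝ} (hρ0 : ∀ u, 0 ≤ ρ u) (hρm : Measurable ρ)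
    (hρi : Integrable ρ) (hρ1 : ∫ u, ρ u = 1) (hρs : ∀ u, ρ (-u) = ρ u) (N : ℝ)
    (hs : Summable fun k => (∫ φ, (max (-N) (min N (latticePhi4Action J lam φ))
          - gibbsExpect J lam (fun ψ => max (-N) (min N (latticePhi4Action J lam ψ))))
        * ((metroScan J lam ρ)^[(n + 1) * (k + 1)] (fun ψ => max (-N) (min N (latticePhi4Action J lam ψ))
          - gibbsExpect J lam (fun ψ => max (-N) (min N (latticePhi4Action J lam ψ))))) φ
        * gibbsWeight J lam φ)
        / ∫ φ, (max (-N) (min N (latticePhi4Action J lam φ))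
          - gibbsExpect J lam (fun ψ => max (-N) (min N (latticePhi4Action J lam ψ)))) ^ 2
          * gibbsWeight J lam φ)
    (hρV : (∫ φ, (max (-N) (min N (latticePhi4Action J lam φ))
          - gibbsExpect J lam (fun ψ => max (-N) (min N (latticePhi4Action J lam ψ))))
        * ((metroScan J lam ρ)^[n + 1] (fun ψ => max (-N) (min N (latticePhi4Action J lam ψ))
          - gibbsExpect J lam (fun ψ => max (-N) (min N (latticePhi4Action J lam ψ))))) φ
        * gibbsWeight J lam φ)
        / (∫ φ, (max (-N) (min N (latticePhi4Action J lam φ))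
          - gibbsExpect J lam (fun ψ => max (-N) (min N (latticePhi4Action J lam ψ)))) ^ 2
          * gibbsWeight J lam φ) < 1) :
    Real.exp 2 / 4 * gibbsExpect J lam (fun φ => (max (-N) (min N (latticePhi4Action J lam φ))
          - gibbsExpect J lam (fun ψ => max (-N) (min N (latticePhi4Action J lam ψ)))) ^ 2)
        / (n + 1) - 1 / 2
      ≤ tauInt (fun k => (∫ φ, (max (-N) (min N (latticePhi4Action J lam φ))
          - gibbsExpect J lam (fun ψ => max (-N) (min N (latticePhi4Action J lam ψ))))
        * ((metroScan J lam ρ)^[(n + 1) * k] (fun ψ => max (-N) (min N (latticePhi4Action J lam ψ))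
          - gibbsExpect J lam (fun ψ => max (-N) (min N (latticePhi4Action J lam ψ))))) φ
        * gibbsWeight J lam φ)
        / ∫ φ, (max (-N) (min N (latticePhi4Action J lam φ))
          - gibbsExpect J lam (fun ψ => max (-N) (min N (latticePhi4Action J lam ψ)))) ^ 2
          * gibbsWeight J lam φ) :=
  metropolisScan_tauInt_sweep_ge_energy hlam J hρ0 hρm hρi hρ1 hρs (clipAction_bddObs J lam N)
    (fun φ x t' => clipAction_lipschitz J lam N φ x t') hs hρV

end ActionCSD

end Summit.Ventures.LatticeQCDFlow.Exactness
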